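import Literature.NumberTheory.Rogawski1990.ArchOrbitalIntegralContinuityPlaces   -- ★ (W1-cont-Π) LH2-p04 (g3): per-place (HYP) at regular sets §1–§3, `forall_mem_mul_comm_archPiEquivCM_symm`; brings ★ FILE 1 `uniformlyProper_pi ∕ _map_mulEquiv`
import Literature.NumberTheory.Automorphic.UnitaryGroupArchTopology                 -- ★ instances `LocallyCompactSpace ∕ T2Space ∕ IsTopologicalGroup` on `arch …`
import Literature.MeasureTheory.Group.InvariantQuotientExistence                    -- ★ `exists_isCompact_image_mk_superset` (compact sets of `G ⧸ M` lift)
import HarnessLib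

/-!
# Harish-Chandra's compactness lemma on `G′_∞ = U(H′)(L⁺ ⊗ ℝ) ≅ Π_w U(σ_w H′)(ℂ)`: the places assembly, modulo a product subgroup `M′ ↔ Π_w M_w`
# (Rogawski 1990 §4.12 Lemma 4.12.1, §4.3, §8.2; Harish-Chandra–van Dijk 1970 Part I §3 Lemma 22; Folland 1995 Thm. 2.49; Deitmar–Echterhoff 2014 Lemma 9.3.3, Rem. 1.5.2)

Topic `NumberTheory/Rogawski1990`; namespace `Literature.NumberTheory.Rogawski1990`.  THEOREMS ONLY (no `def`, no instance, no notation, no axiom, no named fact, no `sorry`).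
Cell `pub/hodgecm-mathlib`, crux H413 (`stmt-HodgeConjecture-24833`), F0∕P3c line LH3 (closer stub `stub_N9`, organ J), brick **(J-DESC) FILE D4a** (seat F0P3a-p08 (g22)):
the `G′_∞`-level «compact modulo `M′`» statement that the descent ★ `exists_descended_forall_orbitalIntegral_eq` (D2) ∕ ★ `integral_descConj_eq_integral_descConj_descended`
(D3) consume, ASSEMBLED from per-place (HYP) statements exactly as ★ `continuousOn_integral_descConj_arch_of_uniformlyProper_places` ((W1-cont-Π), LH2-p04 (g3)) assembles
continuity: ★ `uniformlyProper_pi` («places multiply») ∘ ★ `uniformlyProper_map_mulEquiv` (along `archPiEquivCM⁻¹`), then ★ `exists_isCompact_image_mk_superset` to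
return to the group.  Per place one feeds: at the SEMI-REGULAR place `w₀` ★ D1c `uniformlyProper_circleDiagonal_of_ne` (modulo `M_{w₀} = Z(s_{w₀}) ≥ Stab(e_k)`, ACROSS the
noncompact wall), at the other places the ★ regular-set feeders of (W1-cont-Π) §1–§3 (`uniformlyProper_centralizer_map_of_diag_hyperbolic`, `uniformlyProper_circleDiagonal`,
`uniformlyProper_archLocal_of_definite`) modulo `M_w = T_w`.
* **`uniformlyProper_arch_of_places`** — (HYP) for the product chart `x ↦ archPiEquivCM⁻¹ (c_w(x_w))_w` modulo `M′` on `Set.pi univ S`, from (HYP) at every place;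
* **`exists_isCompact_mul_arch_of_places`** — the group-level form: ONE compact `C″ ⊆ G′_∞` with `y′ ∈ C″·M′` whenever `y′·archPiEquivCM⁻¹(c(x))·y′⁻¹ ∈ C′` for some
  `x ∈ K` (`K ⊆ Set.pi univ S` compact) — the uniform `hCM` binder of D2∕D3 on `G′_∞`.
HONEST LABEL: HC_CM is proved only modulo the 7 printed citations (2 remaining named inputs: hLiu418 = `stmt-HodgeConjecture-24832`, h413 = `stmt-HodgeConjecture-24833`) until rung 0
closes; count-neutral topology under organ J of `stub_N9`.

## References
* [Rogawski1990] J. D. Rogawski, *Automorphic Representations of Unitary Groups in Three Variables*, Ann. of Math. Stud. 123 (1990), §4.12 Lemma 4.12.1 p. 66, §8.2 p. 114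
  (the compactness lemma), §4.3 p. 43 (`G_∞ = Π_w G_w`).
* [HarishChandra1970] Harish-Chandra (notes by G. van Dijk), *Harmonic Analysis on Reductive p-adic Groups*, LNM 162 (1970), Part I §3 Lemma 22.
* [Folland1995] G. B. Folland, *A Course in Abstract Harmonic Analysis* (1995), §2.6 Thm. 2.49 (products, quotients).
* [DeitmarEchterhoff2014] A. Deitmar, S. Echterhoff, *Principles of Harmonic Analysis*, 2nd ed. (2014), Lemma 9.3.3, Remark 1.5.2.
-/

set_option autoImplicit false

noncomputable section

open MeasureTheory Set Topology NumberField NumberField.InfinitePlace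
open Literature.MeasureTheory.Group Literature.NumberTheory.Automorphic Literature.NumberTheory.Automorphic.UnitaryGroup
open scoped MatrixGroups Matrix Pointwise

namespace Literature.NumberTheory.Rogawski1990

section Assembly

variable (L : Type) [Field L] [NumberField L] [IsCMField L] (N : ℕ) (H : Matrix (Fin N) (Fin N) L)

/-- **THE COMPACTNESS LEMMA ON `G′_∞`, ASSEMBLED OVER THE PLACES ((HYP) form).**  Per-place charts `c_w : X_w → G′_w` uniformly proper modulo `M_w` on `S_w`, and
`M′ ≤ G′_∞` corresponding to `Π_w M_w` under ★ `archPiEquivCM`: then the product chart `x ↦ archPiEquivCM⁻¹ (c_w(x_w))_w` is uniformly proper modulo `M′` on `Set.pi univ S`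
(★ `uniformlyProper_map_mulEquiv` ∘ ★ `uniformlyProper_pi`).  At a semi-regular compact-chart point: `S_{w₀}` = a neighbourhood of the wall on which the third eigenvalue stays
simple (★ `uniformlyProper_circleDiagonal_of_ne`, `M_{w₀} = Z(s_{w₀})`), `S_w` = the regular set elsewhere (★ (W1-cont-Π) §1–§3, `M_w = T_w`).
[cite: Rogawski1990, §4.12 Lemma 4.12.1 p. 66; §4.3 p. 43] [cite: HarishChandra1970, Part I §3 Lemma 22] [cite: Folland1995, §2.6 Thm. 2.49] -/
theorem uniformlyProper_arch_of_places {X : {w : InfinitePlace L // IsComplex w} → Type*} [∀ w, TopologicalSpace (X w)]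
    (M : ∀ w, Subgroup ↥(archLocal L N H w)) (M' : Subgroup ↥(arch (↥(maximalRealSubfield L)) L (IsCMField.complexConj L) N H))
    (hMM' : ∀ g, (archPiEquivCM N L H).symm g ∈ M' ↔ g ∈ Subgroup.pi Set.univ M)
    (c : ∀ w, X w → ↥(archLocal L N H w)) (S : ∀ w, Set (X w))
    (hprop : ∀ w, ∀ K ⊆ S w, IsCompact K → ∀ C : Set ↥(archLocal L N H w), IsCompact C →
      ∃ 𝒦 : Set (↥(archLocal L N H w) ⧸ M w), IsCompact 𝒦 ∧
        ∀ x ∈ K, ∀ y : ↥(archLocal L N H w), y * c w x * y⁻¹ ∈ C → (QuotientGroup.mk y : ↥(archLocal L N H w) ⧸ M w) ∈ 𝒦) :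
    ∀ K ⊆ Set.pi Set.univ S, IsCompact K → ∀ C' : Set ↥(arch (↥(maximalRealSubfield L)) L (IsCMField.complexConj L) N H), IsCompact C' →
      ∃ 𝒦' : Set (↥(arch (↥(maximalRealSubfield L)) L (IsCMField.complexConj L) N H) ⧸ M'), IsCompact 𝒦' ∧
        ∀ x ∈ K, ∀ y' : ↥(arch (↥(maximalRealSubfield L)) L (IsCMField.complexConj L) N H),
          y' * (archPiEquivCM N L H).symm (fun w => c w (x w)) * y'⁻¹ ∈ C' →
            (QuotientGroup.mk y' : ↥(arch (↥(maximalRealSubfield L)) L (IsCMField.complexConj L) N H) ⧸ M') ∈ 𝒦' :=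
  uniformlyProper_map_mulEquiv (archPiEquivCM N L H).symm.toMulEquiv (archPiEquivCM N L H).symm.continuous (archPiEquivCM N L H).continuous
    (Subgroup.pi Set.univ M) M' hMM' (fun x : ∀ w, X w => fun w => c w (x w)) (uniformlyProper_pi M c S hprop)

/-- **Group-level form on `G′_∞`**: ONE compact `C″ ⊆ G′_∞` with `y′ ∈ C″·M′` whenever `y′·archPiEquivCM⁻¹(c(x))·y′⁻¹ ∈ C′` for some `x ∈ K` (`K ⊆ Set.pi univ S` compact) —
the uniform «compact modulo `M′`» binder `hCM` of ★ `exists_descended_forall_orbitalIntegral_eq` ∕ ★ `integral_descConj_eq_integral_descConj_descended` (compact sets of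
`G′_∞ ⧸ M′` lift, ★ `exists_isCompact_image_mk_superset`). [cite: Rogawski1990, §4.12 Lemma 4.12.1 p. 66; §8.2 p. 114] [cite: DeitmarEchterhoff2014, Remark 1.5.2; Lemma 9.3.3] -/
theorem exists_isCompact_mul_arch_of_places {X : {w : InfinitePlace L // IsComplex w} → Type*} [∀ w, TopologicalSpace (X w)]
    (M : ∀ w, Subgroup ↥(archLocal L N H w)) (M' : Subgroup ↥(arch (↥(maximalRealSubfield L)) L (IsCMField.complexConj L) N H))
    (hMM' : ∀ g, (archPiEquivCM N L H).symm g ∈ M' ↔ g ∈ Subgroup.pi Set.univ M)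
    (c : ∀ w, X w → ↥(archLocal L N H w)) (S : ∀ w, Set (X w))
    (hprop : ∀ w, ∀ K ⊆ S w, IsCompact K → ∀ C : Set ↥(archLocal L N H w), IsCompact C →
      ∃ 𝒦 : Set (↥(archLocal L N H w) ⧸ M w), IsCompact 𝒦 ∧
        ∀ x ∈ K, ∀ y : ↥(archLocal L N H w), y * c w x * y⁻¹ ∈ C → (QuotientGroup.mk y : ↥(archLocal L N H w) ⧸ M w) ∈ 𝒦)
    {K : Set (∀ w, X w)} (hKS : K ⊆ Set.pi Set.univ S) (hK : IsCompact K)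
    {C' : Set ↥(arch (↥(maximalRealSubfield L)) L (IsCMField.complexConj L) N H)} (hC' : IsCompact C') :
    ∃ C'' : Set ↥(arch (↥(maximalRealSubfield L)) L (IsCMField.complexConj L) N H), IsCompact C'' ∧
      ∀ x ∈ K, ∀ y' : ↥(arch (↥(maximalRealSubfield L)) L (IsCMField.complexConj L) N H),
        y' * (archPiEquivCM N L H).symm (fun w => c w (x w)) * y'⁻¹ ∈ C' →
          y' ∈ C'' * (M' : Set ↥(arch (↥(maximalRealSubfield L)) L (IsCMField.complexConj L) N H)) := by
  obtain ⟨𝒦', h𝒦', hmem⟩ := uniformlyProper_arch_of_places L N H M M' hMM' c S hprop K hKS hK C' hC'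
  obtain ⟨C'', hC'', hsub⟩ := exists_isCompact_image_mk_superset M' h𝒦'
  refine ⟨C'', hC'', fun x hx y' hy' => ?_⟩
  obtain ⟨a, ha, hay⟩ := hsub (hmem x hx y' hy')
  rw [QuotientGroup.eq] at hay
  exact ⟨a, ha, a⁻¹ * y', hay, by group⟩

end Assembly

end Literature.NumberTheory.Rogawski1990
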